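import Mathlib
import Summits.Ventures.HodgeRepro2.T6N5TateTwist
import Summits.Ventures.HodgeRepro2.T6N5Hyp
import Summits.Ventures.HodgeRepro2.T6N5LocalDatum
import Summits.Ventures.HodgeRepro2.T6N5LocalHyp
import Summits.Ventures.HodgeRepro2.T6N5Local
import Summits.Ventures.HodgeRepro2.T6N5LocalCharDatum
import Summits.Ventures.HodgeRepro2.T6N5LocalRamHyp
import Summits.Ventures.HodgeRepro2.T6N5LocalRam
import Summits.Ventures.HodgeRepro2.T6N5LocalInertCompletion
import Summits.Ventures.HodgeRepro2.T6N5LocalRamCompletion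
import Summits.Ventures.HodgeRepro2.T6N5LocalRamOnCompletion
import Summits.Ventures.HodgeRepro2.T5LocalNormIndex
import Summits.Ventures.HodgeRepro2.T5NormCharConductor
import Summits.Ventures.HodgeRepro2.T5RamifiedOddConductor

/-!
# T6N5LocalRamOnCompletionAll — Tier 6, M2 sub-step N5 (t6-p8's half): Theorem N5.T2 (ramified case) on
Mathlib's adic completions at EVERY finite ramified place — the tameness hypothesis `IsUnit (2 : O_{K_v})` dropped

`T6N5LocalRamOnCompletion.N5Local_main_ram_completion` instantiates `T6N5LocalRam.N5Local_main_ramified` on the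
ramified datum `mkRam v w hπ σ hind T` with the character-side datum conditions `hU`, `hμ`, `heven`, `hη`
discharged at every ramified place, but `hodd` (a conjugate-symplectic smooth character of ODD conductor —
the route's Lemma N5.L4 (iv-a)) only at TAME places (`T6N5LocalRamCompletion.exists_CS_odd_level`, hypothesis
`h2u : IsUnit (2 : O_{K_v})`, conductor `1`); at WILD places `hodd` stayed a datum condition, because the conductor
of `η_v` at `p = 2` was not in the kernel.

p4's `T5NormCharConductor` / `T5RamifiedOddConductor` put it there: with `f := normCharConductor v w σ ϖ hind ≥ 1`
the conductor exponent of `η_v` (the least `n` with `U_F^{(n)} ⊆ ker η_v`), the extension of `η_v` from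
`F_v^× U_E^{(2f−1)}` to `L_w^×` is conjugate-symplectic, smooth, and of conductor EXACTLY `2f − 1` — odd — at every
ramified place, tame (`f = 1`) or wild, with no hypothesis on the residue characteristic
(`T5RamifiedOddConductor.exists_CS_odd_level_of_ramified`).

This file factors the assembly through the `hodd` shape every such theorem delivers
(`N5Local_main_ram_completion_of_odd`), and states Theorem N5.T2 at every finite ramified place:
`N5Local_main_ram_completion_all` (with `hind`) and `N5Local_main_ram_completion_all'` (`hind` := p4's
`T5LocalNormIndex.index_normGroup_eq_two`). The hypotheses left are exactly those of the tame assembly minus `h2u`: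
the ramified setting (`h2`, `hϖ`, `hπ`, `hram`, `hσ`), the displays `hT6` (Tate (3.2.6.3)), `hG` (GGP Prop. 5.1 (2)),
`h35` (BFGYYZ Thm 3.5), the Tate-side conditions `hω`, `hconj`, and the (A1) / Weil-side inputs `hA1`, `hW`, `hχW`.
The tame theorem is recovered as `N5Local_main_ram_completion_of_tame` (a consistency check: `of_odd` + the tame
`exists_CS_odd_level`).
README §8(d): uses an L-value-free non-vanishing device: NO.
-/

namespace Summit.Ventures.HodgeRepro2.T6.N5LocalRamOnCompletionAll

open Summit.Ventures.HodgeRepro2 IsDedekindDomain HeightOneSpectrum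
  Summit.Ventures.HodgeRepro2.T6.N5LocalDatum Summit.Ventures.HodgeRepro2.T6.N5LocalCharDatum
  Summit.Ventures.HodgeRepro2.T6.N5LocalRamDatum Summit.Ventures.HodgeRepro2.T6.N5Local
  Summit.Ventures.HodgeRepro2.T6.N5LocalRam Summit.Ventures.HodgeRepro2.T6.Hyp
  Summit.Ventures.HodgeRepro2.T6.N5LocalInertCompletion Summit.Ventures.HodgeRepro2.T6.N5LocalRamCompletion
  Summit.Ventures.HodgeRepro2.T6.N5LocalRamOnCompletion

-- `K`, `L` in `Type` (universe `0`): `CharDatum.E : Type`.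
variable {K : Type} [Field K] [NumberField K] (v : HeightOneSpectrum (NumberField.RingOfIntegers K))
  {L : Type} [Field L] [NumberField L] [Algebra K L] (w : HeightOneSpectrum (NumberField.RingOfIntegers L))
  [w.asIdeal.LiesOver v.asIdeal]
  [ContinuousSMul (v.adicCompletion K) (w.adicCompletion L)]
  [IsScalarTower K (v.adicCompletion K) (w.adicCompletion L)]

/-- The ramified assembly factored through the `hodd` shape: `N5Local_main_ramified` on `mkRam`, with `hU`, `hμ`,
`heven`, `hη` discharged by `T6N5LocalRamCompletion` and `hodd` taken in the completion vocabulary — a character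
`ω̃` of `L_w^×` equal to `η_v` on `F_v^×` (conjugate-symplectic), trivial on some `U_E^{(m)}` (smooth), of odd
conductor. No hypothesis on `2`, no `hσ`. -/
theorem N5Local_main_ram_completion_of_odd
    (h2 : Module.finrank (v.adicCompletion K) (w.adicCompletion L) = 2)
    {ϖ : v.adicCompletionIntegers K} (hϖ : Irreducible ϖ) {π : w.adicCompletionIntegers L} (hπ : Irreducible π)
    (hram : ¬ Irreducible (algebraMap (v.adicCompletionIntegers K) (w.adicCompletionIntegers L) ϖ))
    (σ : Gal(w.adicCompletion L/v.adicCompletion K))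
    (hind : (T5AdicCompletionNormGroup.normGroup v w σ).index = 2)
    (hodd : ∃ ω : (w.adicCompletion L)ˣ →* ℂˣ, (∀ f : Fsub v w, ω f = ηF v w σ hind f) ∧
      (∃ m, Uπ w π m ≤ ω.ker) ∧ Odd (T5ConductorArithmetic.conductor (Uπ w π) ω))
    (T : TateSideRam (w.adicCompletion L)ˣ)
    (hT6 : Tate1979_3_2_6_3 (mkRam v w hπ σ hind T)) (hG : GGP2012_Prop5_1_2 (mkRam v w hπ σ hind T))
    (hω : (mkRam v w hπ σ hind T).IsUnramified (T.omega (1 / 2))) (hconj : T.IsConjInv T.ψδ)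
    (h35 : BFGYYZ2025_Thm3_5 (mkRam v w hπ σ hind T).toLocalSignDatum)
    (hA1 : ∀ s : ℤˣ, ∃ α : (w.adicCompletion L)ˣ →* ℂˣ,
      (mkRam v w hπ σ hind T).toLocalSignDatum.IsCO α ∧ T.Theta s α)
    (hW : T.epsdW = 1) (hχW : (mkRam v w hπ σ hind T).toLocalSignDatum.IsCS T.χW) :
    ∃ ξ : Fin 4 → (w.adicCompletion L)ˣ →* ℂˣ, LocalSolution (mkRam v w hπ σ hind T).toLocalSignDatum ξ := by
  refine N5Local_main_ramified (mkRam v w hπ σ hind T) hT6 hG (Uπ_antitone w π) hω hconj ?_ ?_ ?_ h35 hA1 hW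
    (ηF_mul_self v w σ hind) hχW
  · -- `hμ`
    refine ⟨μ w, ?_, μ_mem_Uπ_zero w π, ?_, μ_sq w⟩
    · rw [CharDatum.isCO_iff]
      intro x
      exact μ_isCO v w h2 hϖ hπ hram x.1 x.2
    · show ((μ w (T5LocalFieldUnitsDecomposition.uniformizerUnit π hπ) : ℂˣ) : ℂ) = -1
      rw [μ_uniformizer w hπ]
      rfl
  · -- `hodd`
    obtain ⟨ω, hωF, hωs, hωc⟩ := hodd
    refine ⟨ω, ?_, hωs, hωc⟩
    rw [CharDatum.isCS_iff]
    intro x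
    exact hωF x
  · -- `heven`
    intro k
    obtain ⟨β, hβF, hβs, hβc⟩ := exists_CO_exact_even_level v w h2 hϖ hπ hram k
    refine ⟨β, ?_, hβs, ?_, ?_⟩
    · rw [CharDatum.isCO_iff]
      intro x
      exact hβF x.1 x.2
    · show Even (T5ConductorArithmetic.conductor (Uπ w π) β)
      rw [hβc]
      exact ⟨k + 1, by ring⟩
    · show k < T5ConductorArithmetic.conductor (Uπ w π) β
      rw [hβc]
      omega

/-- Theorem N5.T2 at EVERY finite ramified place on Mathlib's completions (tame or wild): the assembly with
`hodd` := p4's `T5RamifiedOddConductor.exists_CS_odd_level_of_ramified` (the conjugate-symplectic character of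
conductor `2f − 1`, `f` the conductor exponent of `η_v`). Hypotheses: the ramified setting (`h2`, `hϖ`, `hπ`, `hram`,
`hσ`, `hind`) — no `IsUnit 2` —, the displays `hT6`, `hG`, `h35`, the Tate-side conditions `hω`, `hconj`, and the
(A1) / Weil-side inputs `hA1`, `hW`, `hχW`. -/
theorem N5Local_main_ram_completion_all
    (h2 : Module.finrank (v.adicCompletion K) (w.adicCompletion L) = 2)
    {ϖ : v.adicCompletionIntegers K} (hϖ : Irreducible ϖ) {π : w.adicCompletionIntegers L} (hπ : Irreducible π)
    (hram : ¬ Irreducible (algebraMap (v.adicCompletionIntegers K) (w.adicCompletionIntegers L) ϖ))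
    (σ : Gal(w.adicCompletion L/v.adicCompletion K)) (hσ : σ ≠ 1)
    (hind : (T5AdicCompletionNormGroup.normGroup v w σ).index = 2)
    (T : TateSideRam (w.adicCompletion L)ˣ)
    (hT6 : Tate1979_3_2_6_3 (mkRam v w hπ σ hind T)) (hG : GGP2012_Prop5_1_2 (mkRam v w hπ σ hind T))
    (hω : (mkRam v w hπ σ hind T).IsUnramified (T.omega (1 / 2))) (hconj : T.IsConjInv T.ψδ)
    (h35 : BFGYYZ2025_Thm3_5 (mkRam v w hπ σ hind T).toLocalSignDatum)
    (hA1 : ∀ s : ℤˣ, ∃ α : (w.adicCompletion L)ˣ →* ℂˣ,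
      (mkRam v w hπ σ hind T).toLocalSignDatum.IsCO α ∧ T.Theta s α)
    (hW : T.epsdW = 1) (hχW : (mkRam v w hπ σ hind T).toLocalSignDatum.IsCS T.χW) :
    ∃ ξ : Fin 4 → (w.adicCompletion L)ˣ →* ℂˣ, LocalSolution (mkRam v w hπ σ hind T).toLocalSignDatum ξ :=
  N5Local_main_ram_completion_of_odd v w h2 hϖ hπ hram σ hind
    (T5RamifiedOddConductor.exists_CS_odd_level_of_ramified v w h2 hϖ hπ hram σ hσ hind)
    T hT6 hG hω hconj h35 hA1 hW hχW

/-- Theorem N5.T2 at every finite ramified place, with the norm index `[F_v^× : N E_v^×] = 2` supplied by p4's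
`T5LocalNormIndex.index_normGroup_eq_two` (from `[L_w : K_v] = 2` and `σ ≠ 1`): the statement of record for the
ramified places, tame or wild. -/
theorem N5Local_main_ram_completion_all'
    (h2 : Module.finrank (v.adicCompletion K) (w.adicCompletion L) = 2)
    {ϖ : v.adicCompletionIntegers K} (hϖ : Irreducible ϖ) {π : w.adicCompletionIntegers L} (hπ : Irreducible π)
    (hram : ¬ Irreducible (algebraMap (v.adicCompletionIntegers K) (w.adicCompletionIntegers L) ϖ))
    (σ : Gal(w.adicCompletion L/v.adicCompletion K)) (hσ : σ ≠ 1)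
    (T : TateSideRam (w.adicCompletion L)ˣ)
    (hT6 : Tate1979_3_2_6_3 (mkRam v w hπ σ (T5LocalNormIndex.index_normGroup_eq_two v w σ h2 hσ) T))
    (hG : GGP2012_Prop5_1_2 (mkRam v w hπ σ (T5LocalNormIndex.index_normGroup_eq_two v w σ h2 hσ) T))
    (hω : (mkRam v w hπ σ (T5LocalNormIndex.index_normGroup_eq_two v w σ h2 hσ) T).IsUnramified
      (T.omega (1 / 2)))
    (hconj : T.IsConjInv T.ψδ)
    (h35 : BFGYYZ2025_Thm3_5
      (mkRam v w hπ σ (T5LocalNormIndex.index_normGroup_eq_two v w σ h2 hσ) T).toLocalSignDatum)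
    (hA1 : ∀ s : ℤˣ, ∃ α : (w.adicCompletion L)ˣ →* ℂˣ,
      (mkRam v w hπ σ (T5LocalNormIndex.index_normGroup_eq_two v w σ h2 hσ) T).toLocalSignDatum.IsCO α ∧
        T.Theta s α)
    (hW : T.epsdW = 1)
    (hχW : (mkRam v w hπ σ (T5LocalNormIndex.index_normGroup_eq_two v w σ h2 hσ) T).toLocalSignDatum.IsCS
      T.χW) :
    ∃ ξ : Fin 4 → (w.adicCompletion L)ˣ →* ℂˣ,
      LocalSolution (mkRam v w hπ σ (T5LocalNormIndex.index_normGroup_eq_two v w σ h2 hσ) T).toLocalSignDatum ξ :=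
  N5Local_main_ram_completion_all v w h2 hϖ hπ hram σ hσ _ T hT6 hG hω hconj h35 hA1 hW hχW

/-- Consistency check: the TAME assembly `T6N5LocalRamOnCompletion.N5Local_main_ram_completion` is the special case
`hodd := T6N5LocalRamCompletion.exists_CS_odd_level` (conductor `1`) of `N5Local_main_ram_completion_of_odd`. -/
theorem N5Local_main_ram_completion_of_tame
    (h2 : Module.finrank (v.adicCompletion K) (w.adicCompletion L) = 2)
    {ϖ : v.adicCompletionIntegers K} (hϖ : Irreducible ϖ) {π : w.adicCompletionIntegers L} (hπ : Irreducible π)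
    (hram : ¬ Irreducible (algebraMap (v.adicCompletionIntegers K) (w.adicCompletionIntegers L) ϖ))
    (σ : Gal(w.adicCompletion L/v.adicCompletion K)) (hσ : σ ≠ 1) (h2u : IsUnit (2 : v.adicCompletionIntegers K))
    (hind : (T5AdicCompletionNormGroup.normGroup v w σ).index = 2) (T : TateSideRam (w.adicCompletion L)ˣ)
    (hT6 : Tate1979_3_2_6_3 (mkRam v w hπ σ hind T)) (hG : GGP2012_Prop5_1_2 (mkRam v w hπ σ hind T))
    (hω : (mkRam v w hπ σ hind T).IsUnramified (T.omega (1 / 2))) (hconj : T.IsConjInv T.ψδ)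
    (h35 : BFGYYZ2025_Thm3_5 (mkRam v w hπ σ hind T).toLocalSignDatum)
    (hA1 : ∀ s : ℤˣ, ∃ α : (w.adicCompletion L)ˣ →* ℂˣ,
      (mkRam v w hπ σ hind T).toLocalSignDatum.IsCO α ∧ T.Theta s α)
    (hW : T.epsdW = 1) (hχW : (mkRam v w hπ σ hind T).toLocalSignDatum.IsCS T.χW) :
    ∃ ξ : Fin 4 → (w.adicCompletion L)ˣ →* ℂˣ, LocalSolution (mkRam v w hπ σ hind T).toLocalSignDatum ξ := by
  refine N5Local_main_ram_completion_of_odd v w h2 hϖ hπ hram σ hind ?_ T hT6 hG hω hconj h35 hA1 hW hχW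
  obtain ⟨ω, hωF, hωs, hωc⟩ := exists_CS_odd_level v w h2 hϖ hπ hram σ hσ h2u hind
  exact ⟨ω, hωF, hωs, hωc ▸ odd_one⟩

end Summit.Ventures.HodgeRepro2.T6.N5LocalRamOnCompletionAll
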